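import Literature.NumberTheory.EllipticCurves.PAdicOneVariableGaloisMomentsOfColemanTraceTwo
import Literature.NumberTheory.GaloisRepresentations.LubinTateTowerCharacterCells
import HarnessLib

/-!
# `p = 2`, fully local: de Shalit's I.3.3–3.5 for the log-free measure of a trace-zero Coleman series —
# `∫_{Γ_F} 𝟙_{U_0}(σ) χ(σ)^{k+1} dD(σ) = [S^0] D^k (θ(h₀ ∘ ϑ))` along the Lubin–Tate tower of `f' = π'X + X²`

Topic `NumberTheory/EllipticCurves`; namespace `Literature.NumberTheory.EllipticCurves`.

De Shalit, *Iwasawa theory of elliptic curves with complex multiplication* (1987), I.3.3 (7)–(9), I.3.4 (10),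
I.3.5 (11): the measure `μ_β` on `G = Gal(k_ξ/k')` of a norm-coherent unit `β`, obtained from its Coleman
series through `θ : Ĝ_m ≃ F_{f'}`, the restriction to `ℤ_p^×` and the pull-back along `κ : G ≃ ℤ_p^×`, has
moments `∫_G κ^k dμ_β = D^k log g_β(0)`.  This file instantiates the abstract composite
`integral_comap_character_pow_succ_of_colemanTrace_eq_zero` (`PAdicOneVariableGaloisMomentsOfColemanTraceTwo.lean`:
seam + support criterion + socket + pull-back along an abstract character) at the CONCRETE Lubin–Tate tower of
`f' = π'X + X²` over `F` and its character (`LubinTateTowerCharacterCells.lean`: `ltTower hπ'`,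
`κ = e ∘ χ_{π'}` with `mem_ltTower_iff` = hU, `exists_toZModPow_ltCharacter_eq` = hκ, `exists_ltCellMap` ⊢ ψ):

* ★★★ `integral_comap_ltCharacter_pow_succ_of_colemanTrace_eq_zero` — for `F` with `|𝓀_F| = 2`, `2` a
  uniformiser, `π' = 2u`, any ring iso `e : 𝒪[F] ≃ ℤ_2`, any continuous `θ : ℂ_F → ℂ_[2]` of norm `≤ 1` on
  `𝒪_{ℂ_F}` reaching the `2`-power roots of unity, any cell maps `ψ` lying over `κ`, and every `h₀ ∈ 𝒪[F]⟦X⟧`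
  with `𝒮_{f'} h₀ = 0`:
  **`∫_{Γ_F} 𝟙_{U_0}(σ) κ(σ)^{k+1} d(comap μ♭ ψ)(σ) = [S^0] D^k (θ(h₀ ∘ ϑ))`**, `μ♭ = restrictUnits (x⁻¹·D_{θ(h₀∘ϑ)})`;
* ★★★ `PadicTwo.integral_comap_ltCharacter_pow_succ_of_colemanTrace_eq_zero` — the same for `F = ℚ_[2]`,
  `θ = CompletedAlgClosure.equivPadicComplex 2`.

Everything is proved; no named facts, no definitions, no instances (one section-local instance attribute for the
normality of the tower, as in `LubinTateTowerCharacterCells.lean`), no `sorry`.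

## References

* [deShalit1987] E. de Shalit, *Iwasawa theory of elliptic curves with complex multiplication* (1987),
  I.3.3 (7)–(9) (p. 17–18), I.3.4 (10), I.3.5 (11) (p. 18).
-/

noncomputable section

open MvPowerSeries Filter
open scoped PowerSeries.WithPiTopology Topology Classical

namespace Literature.NumberTheory.EllipticCurves

section LubinTateTowerMomentsTwo

open ValuativeRel IsLocalRing Field
open Literature.NumberTheory.GaloisRepresentations Literature.NumberTheory.GaloisRepresentations.IsNonarchimedeanLocalField
  Literature.NumberTheory.GaloisRepresentations.LubinTate Literature.NumberTheory.PAdicHodge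

variable {F : Type} [Field F] [ValuativeRel F] [TopologicalSpace F] [IsNonarchimedeanLocalField F]

attribute [local instance] ltNormUniformSpace ltNormIsUniformAddGroup rk1 nF nE fintypeResidueField
attribute [local instance] ltTower_U_normal

variable (hq : residueFieldCard F = 2) (h2 : (valuation F).IsUniformizer (((2 : ℕ) : 𝒪[F]) : F))
  {σ₀ : absoluteGaloisGroup F} (hσ₀ : IsAbsArithFrob σ₀) (u : 𝒪[F]ˣ)
  {ε : (maxUnramifiedCompletion F)ˣ}
  (hε : maxUnramifiedCompletion.galAut F σ₀ (ε : maxUnramifiedCompletion F) =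
    algebraMap 𝒪[F] (maxUnramifiedCompletion F) (u : 𝒪[F]) * (ε : maxUnramifiedCompletion F))
variable (θ : CompletedAlgClosure F →+* ℂ_[2]) (hθc : Continuous θ)
  (hθ1 : ∀ z : CBall F, ‖θ (z : CompletedAlgClosure F)‖ ≤ 1)
  (hθζ : ∀ ζ' : ℂ_[2], (∃ n : ℕ, ζ' ^ 2 ^ n = 1) →
    ∃ ζ : CompletedAlgClosure F, (∃ n : ℕ, ζ ^ 2 ^ n = 1) ∧ θ ζ = ζ')
variable (e : 𝒪[F] ≃+* ℤ_[2])
  (ψ : (n : ℕ) → absoluteGaloisGroup F ⧸ (ltTower (isUniformizer_unit_mul h2 u)).U n → ZMod (2 ^ (n + 1)))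
  (hψ : ∀ (n : ℕ) (σ : absoluteGaloisGroup F), σ ∈ (ltTower (isUniformizer_unit_mul h2 u)).U 0 →
    ψ n ((ltTower (isUniformizer_unit_mul h2 u)).proj n σ) = PadicInt.toZModPow (n + 1)
      (((Units.map (e : 𝒪[F] →+* ℤ_[2]).toMonoidHom).comp (lubinTateCharHom (isUniformizer_unit_mul h2 u)) σ :
        ℤ_[2]ˣ) : ℤ_[2]))

include hq hθc hθζ in
/-- ★★★ **De Shalit I.3.3–3.5 at `p = 2`, local and concrete**: along the Lubin–Tate tower `U_n = Gal(F̄/K_{π'}^{n+1})`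
of `f' = π'X + X²` and its character `κ = e ∘ χ_{π'} : Γ_F → ℤ_2ˣ`, for every `h₀ ∈ 𝒪[F]⟦X⟧` with `𝒮_{f'} h₀ = 0`
and `H' := θ(h₀ ∘ ϑ)`: **`∫_{Γ_F} 𝟙_{U_0}(σ) κ(σ)^{k+1} d(comap (restrictUnits (x⁻¹·D_{H'})) ψ)(σ) = [S^0] D^k H'`**.
[cite: deShalit1987, I.3.4 (10), I.3.5 (11) (p. 18)] -/
theorem integral_comap_ltCharacter_pow_succ_of_colemanTrace_eq_zero (n : ℕ) (h₀ : PowerSeries (LTCoeff F))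
    (hS : colemanTrace (isUniformizer_unit_mul h2 u) n h₀ = 0) (k : ℕ) :
    (GroupDistribution.comap (restrictUnits ((invAmice₁ 2
        ((PowerSeries.subst ((compSeriesC h2 hσ₀ u hε).map (algebraMap (UnrCoeff F) (CBall F)))
          (h₀.map ((algebraMap (UnrCoeff F) (CBall F)).comp
            ((intToUnrCoeff F).comp (LTCoeff.of F).symm.toRingHom)))).map (θ.comp (CBall F).subtype))
        (norm_coeff_map_le_one θ hθ1
          (PowerSeries.subst ((compSeriesC h2 hσ₀ u hε).map (algebraMap (UnrCoeff F) (CBall F)))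
            (h₀.map ((algebraMap (UnrCoeff F) (CBall F)).comp
              ((intToUnrCoeff F).comp (LTCoeff.of F).symm.toRingHom)))))).density
        (ProfiniteTower.padicInt_isUniform 2) (unitInv ℂ_[2]) uniformContinuous_unitInv norm_unitInv_le))
        ψ ((ltTower (isUniformizer_unit_mul h2 u)).cellMap_trans _ ψ hψ)
        ((ltTower (isUniformizer_unit_mul h2 u)).cellMap_injective _
          (mem_ltTower_iff (isUniformizer_unit_mul h2 u) e) ψ hψ)
        ((ltTower (isUniformizer_unit_mul h2 u)).cellMap_fiberSurj _
          (mem_ltTower_iff (isUniformizer_unit_mul h2 u) e)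
          (exists_toZModPow_ltCharacter_eq (isUniformizer_unit_mul h2 u) e) ψ hψ)).integral
        (fun σ ↦ (if (ltTower (isUniformizer_unit_mul h2 u)).proj 0 σ = 1 then (1 : ℂ_[2]) else 0) *
          padicIntCast ℂ_[2]
            ((((Units.map (e : 𝒪[F] →+* ℤ_[2]).toMonoidHom).comp (lubinTateCharHom (isUniformizer_unit_mul h2 u))
              σ : ℤ_[2]ˣ) : ℤ_[2]) ^ (k + 1))) =
      PowerSeries.constantCoeff (mahlerD^[k]
        ((PowerSeries.subst ((compSeriesC h2 hσ₀ u hε).map (algebraMap (UnrCoeff F) (CBall F)))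
          (h₀.map ((algebraMap (UnrCoeff F) (CBall F)).comp
            ((intToUnrCoeff F).comp (LTCoeff.of F).symm.toRingHom)))).map (θ.comp (CBall F).subtype))) :=
  integral_comap_character_pow_succ_of_colemanTrace_eq_zero hq h2 hσ₀ u hε θ hθc hθ1 hθζ _
    (mem_ltTower_iff (isUniformizer_unit_mul h2 u) e) (exists_toZModPow_ltCharacter_eq (isUniformizer_unit_mul h2 u) e)
    ψ hψ n h₀ hS k

end LubinTateTowerMomentsTwo

namespace PadicTwo

open ValuativeRel IsLocalRing Field
open Literature.NumberTheory.GaloisRepresentations Literature.NumberTheory.GaloisRepresentations.IsNonarchimedeanLocalField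
  Literature.NumberTheory.GaloisRepresentations.LubinTate Literature.NumberTheory.PAdicHodge

attribute [local instance] ltNormUniformSpace ltNormIsUniformAddGroup rk1 nF nE fintypeResidueField
attribute [local instance] ltTower_U_normal

/-- ★★★ **`F = ℚ₂`, `θ = equivPadicComplex 2`: de Shalit I.3.3–3.5 for the log-free measure of a trace-zero
Coleman series along the Lubin–Tate tower of `f' = 2uX + X²`** — `∫_{Γ_{ℚ₂}} 𝟙_{U_0} κ^{k+1} d(comap μ♭ ψ) =
[S^0] D^k (θ(h₀ ∘ ϑ))`, for every ring iso `e : 𝒪[ℚ_[2]] ≃ ℤ_[2]`, cell maps `ψ` over `κ = e ∘ χ`, uniformiser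
`2u`, arithmetic Frobenius `σ₀`, Lang unit `ε`, and trace-zero `h₀`. [cite: deShalit1987, I.3.4 (10), I.3.5 (11) (p. 18)] -/
theorem integral_comap_ltCharacter_pow_succ_of_colemanTrace_eq_zero :
    haveI := Padic.isNonarchimedeanLocalField_holds 2
    ∀ {σ₀ : absoluteGaloisGroup ℚ_[2]} (hσ₀ : IsAbsArithFrob σ₀) (u : 𝒪[ℚ_[2]]ˣ)
      {ε : (maxUnramifiedCompletion ℚ_[2])ˣ}
      (hε : maxUnramifiedCompletion.galAut ℚ_[2] σ₀ (ε : maxUnramifiedCompletion ℚ_[2]) =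
        algebraMap 𝒪[ℚ_[2]] (maxUnramifiedCompletion ℚ_[2]) (u : 𝒪[ℚ_[2]]) * (ε : maxUnramifiedCompletion ℚ_[2]))
      (e : 𝒪[ℚ_[2]] ≃+* ℤ_[2])
      (ψ : (n : ℕ) → absoluteGaloisGroup ℚ_[2] ⧸
        (ltTower (isUniformizer_unit_mul (Padic.isUniformizer_natCast 2) u)).U n → ZMod (2 ^ (n + 1)))
      (hψ : ∀ (n : ℕ) (σ : absoluteGaloisGroup ℚ_[2]),
        σ ∈ (ltTower (isUniformizer_unit_mul (Padic.isUniformizer_natCast 2) u)).U 0 →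
        ψ n ((ltTower (isUniformizer_unit_mul (Padic.isUniformizer_natCast 2) u)).proj n σ) =
          PadicInt.toZModPow (n + 1) (((Units.map (e : 𝒪[ℚ_[2]] →+* ℤ_[2]).toMonoidHom).comp
            (lubinTateCharHom (isUniformizer_unit_mul (Padic.isUniformizer_natCast 2) u)) σ : ℤ_[2]ˣ) : ℤ_[2]))
      (n : ℕ) (h₀ : PowerSeries (LTCoeff ℚ_[2]))
      (_hS : colemanTrace (isUniformizer_unit_mul (Padic.isUniformizer_natCast 2) u) n h₀ = 0) (k : ℕ),
      (GroupDistribution.comap (restrictUnits ((invAmice₁ 2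
        ((PowerSeries.subst ((compSeriesC (Padic.isUniformizer_natCast 2) hσ₀ u hε).map
            (algebraMap (UnrCoeff ℚ_[2]) (CBall ℚ_[2])))
          (h₀.map ((algebraMap (UnrCoeff ℚ_[2]) (CBall ℚ_[2])).comp
            ((intToUnrCoeff ℚ_[2]).comp (LTCoeff.of ℚ_[2]).symm.toRingHom)))).map
          ((CompletedAlgClosure.equivPadicComplex 2).toRingHom.comp (CBall ℚ_[2]).subtype))
        (norm_coeff_map_le_one _ norm_equivPadicComplex_coe_cBall_le_one _)).density
        (ProfiniteTower.padicInt_isUniform 2) (unitInv ℂ_[2]) uniformContinuous_unitInv norm_unitInv_le))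
        ψ ((ltTower (isUniformizer_unit_mul (Padic.isUniformizer_natCast 2) u)).cellMap_trans _ ψ hψ)
        ((ltTower (isUniformizer_unit_mul (Padic.isUniformizer_natCast 2) u)).cellMap_injective _
          (mem_ltTower_iff (isUniformizer_unit_mul (Padic.isUniformizer_natCast 2) u) e) ψ hψ)
        ((ltTower (isUniformizer_unit_mul (Padic.isUniformizer_natCast 2) u)).cellMap_fiberSurj _
          (mem_ltTower_iff (isUniformizer_unit_mul (Padic.isUniformizer_natCast 2) u) e)
          (exists_toZModPow_ltCharacter_eq (isUniformizer_unit_mul (Padic.isUniformizer_natCast 2) u) e)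
          ψ hψ)).integral
        (fun σ ↦ (if (ltTower (isUniformizer_unit_mul (Padic.isUniformizer_natCast 2) u)).proj 0 σ = 1
            then (1 : ℂ_[2]) else 0) *
          padicIntCast ℂ_[2]
            ((((Units.map (e : 𝒪[ℚ_[2]] →+* ℤ_[2]).toMonoidHom).comp
              (lubinTateCharHom (isUniformizer_unit_mul (Padic.isUniformizer_natCast 2) u)) σ : ℤ_[2]ˣ) :
                ℤ_[2]) ^ (k + 1))) =
      PowerSeries.constantCoeff (mahlerD^[k]
        ((PowerSeries.subst ((compSeriesC (Padic.isUniformizer_natCast 2) hσ₀ u hε).map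
            (algebraMap (UnrCoeff ℚ_[2]) (CBall ℚ_[2])))
          (h₀.map ((algebraMap (UnrCoeff ℚ_[2]) (CBall ℚ_[2])).comp
            ((intToUnrCoeff ℚ_[2]).comp (LTCoeff.of ℚ_[2]).symm.toRingHom)))).map
          ((CompletedAlgClosure.equivPadicComplex 2).toRingHom.comp (CBall ℚ_[2]).subtype))) := by
  haveI := Padic.isNonarchimedeanLocalField_holds 2
  intro σ₀ hσ₀ u ε hε e ψ hψ n h₀ hS k
  exact Literature.NumberTheory.EllipticCurves.integral_comap_ltCharacter_pow_succ_of_colemanTrace_eq_zero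
    (Padic.residueFieldCard_eq 2) (Padic.isUniformizer_natCast 2) hσ₀ u hε _
    continuous_equivPadicComplex_toRingHom norm_equivPadicComplex_coe_cBall_le_one
    exists_pow_two_pow_eq_one_equivPadicComplex_eq e ψ hψ n h₀ hS k

end PadicTwo

end Literature.NumberTheory.EllipticCurves

end
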